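import Summits.CriticalPhenomena.PercolationContinuityZ3.Theorems.PercNearOneGluingNoHeavyLowerTailCovTauA2
import HarnessLib

/-!
# `Y` is antitone in the source set — (A2) and P1 ≥ 0 modulo the one-source bounds only

Continues `…CovTauA2.lean`.

* `CovTau.sum_cond_sC` — **conditioning on the value of a set cluster** (the domain Markov property in the
  finite-sum framework, cf. `BHK2006.sum_cond_cluster` for one vertex): for any `Φ`,
  `Σ_ω weight(ω) Φ(C_N(ω), ω ∩ E(U ∖ C_N(ω))) = Σ_ω weight(ω) Σ_ω' weight(ω') Φ(C_N(ω), ω' ∩ E(U ∖ C_N(ω)))`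
  — given `C_N = W`, the edges inside `U ∖ W` are fresh. [cite: VandenbergHaggstromKahn2005, §1 pp. 7–8, display (10)]
* `CovTau.Yf_insert_le`, `CovTau.Yf_antitone_of_le_Bf` — if the one-source
  bound `Y_{U'}({u}) ≤ B_{U'}` holds in every sub-world `U' ⊆ U`, then `Y_U` is antitone in the source set
  (condition on `C_N = W`; adding `u ∉ W` replaces `B(W)` by `Y_{G∖W}({u}) ≤ B(W)`).
* `CovTau.a2`, `CovTau.p1` — (A2) and its diagonal P1 ≥ 0 with hypotheses (★) and (Y ≤ B) only, both one-source
  statements (consequences of the decision-tree Harris inequality [Gladkov2024, Thm. 3.2] and vdBHK Thm. 1.4).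
[cite: VandenbergHaggstromKahn2005, Thm. 1.1 (pp. 3–5), §1 pp. 7–8] [cite: Gladkov2024, Thm. 3.2] [cite: KozmaNitzan2024, Conj. 1 (p. 3)]
-/

noncomputable section

namespace Summit.CriticalPhenomena.PercolationContinuityZ3.Theorems.CovTau

open Literature.Probability.Percolation
open Literature.Probability.Percolation.BHK2006
open Literature.Probability.Percolation.DecisionTree (ind ind_of_mem ind_of_not_mem ind_nonneg)
open scoped Classical

variable {V : Type*}

/-! ### Locality of the value of a set cluster -/

/-- An open path inside `U` starting in a set `W` that is closed under open `U`-edges of `ω` stays in `W`. [folklore] -/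
theorem reach_stays {U : Finset V} {ω : Set (Sym2 V)} {W : Set V} {a b : V}
    (hW : ∀ p q : V, p ∈ W → (openGraph (ω ∩ edgesIn U)).Adj p q → q ∈ W)
    (h : (openGraph (ω ∩ edgesIn U)).Reachable a b) (ha : a ∈ W) : b ∈ W := by
  rw [SimpleGraph.reachable_iff_reflTransGen] at h
  induction h with
  | refl => exact ha
  | tail _ hbc ih => exact hW _ _ ih hbc

/-- **Locality of `{C_N = W}`**: if `C^U_N(ω) = W` and `ω'` agrees with `ω` on the pairs meeting `W`, then
`C^U_N(ω') = W`. [folklore] -/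
theorem sC_eq_of_agree {U : Finset V} {N : Set V} {ω ω' : Set (Sym2 V)} {W : Set V} (hW : sC U N ω = W)
    (hag : ∀ e : Sym2 V, (∃ u ∈ e, u ∈ W) → (e ∈ ω ↔ e ∈ ω')) : sC U N ω' = W := by
  -- `W` is closed under open `U`-edges of `ω'` and of `ω`
  have hcl : ∀ (ξ : Set (Sym2 V)), (∀ e : Sym2 V, (∃ u ∈ e, u ∈ W) → (e ∈ ξ ↔ e ∈ ω)) →
      ∀ p q : V, p ∈ W → (openGraph (ξ ∩ edgesIn U)).Adj p q → q ∈ W := by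
    intro ξ hξ p q hp hpq
    obtain ⟨hξe, hU, hne⟩ := adj_iff.1 hpq
    have hωe : s(p, q) ∈ ω := (hξ _ ⟨p, Sym2.mem_mk_left p q, hp⟩).1 hξe
    rw [← hW] at hp ⊢
    obtain ⟨z, hz, hr⟩ := hp
    exact ⟨z, hz, hr.trans (SimpleGraph.Adj.reachable (adj_iff.2 ⟨hωe, hU, hne⟩))⟩
  have hcl' := hcl ω' fun e he => (hag e he).symm
  have hclω := hcl ω fun _ _ => Iff.rfl
  have hNW : N ⊆ W := by rw [← hW]; exact subset_sC U N ω
  ext u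
  constructor
  · rintro ⟨z, hz, hr⟩
    exact reach_stays hcl' hr (hNW hz)
  · intro hu
    rw [← hW] at hu
    obtain ⟨z, hz, hr⟩ := hu
    refine ⟨z, hz, ?_⟩
    -- the `ω`-path from `z` stays in `W`, so its edges meet `W` and are open in `ω'`
    rw [SimpleGraph.reachable_iff_reflTransGen] at hr ⊢
    induction hr with
    | refl => exact Relation.ReflTransGen.refl
    | @tail b c hab hbc ih =>
      refine ih.tail ?_
      obtain ⟨hωe, hU, hne⟩ := adj_iff.1 hbc
      have hb : b ∈ W := reach_stays hclω ((SimpleGraph.reachable_iff_reflTransGen _ _).2 hab) (hNW hz)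
      exact adj_iff.2 ⟨(hag _ ⟨b, Sym2.mem_mk_left b c, hb⟩).1 hωe, hU, hne⟩

/-- `{C_N = W}` is decided by the pairs meeting `W`. [folklore] -/
theorem sC_inter_meet_eq_iff (U : Finset V) (N : Set V) (ω : Set (Sym2 V)) (W : Set V) :
    sC U N (ω ∩ {e | ∃ u ∈ e, u ∈ W}) = W ↔ sC U N ω = W :=
  ⟨fun h => sC_eq_of_agree h fun _ he => ⟨fun h' => h'.1, fun h' => ⟨h', he⟩⟩,
    fun h => sC_eq_of_agree h fun _ he => ⟨fun h' => ⟨h', he⟩, fun h' => h'.1⟩⟩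

/-- The pairs inside `U ∖ W` do not meet `W`. [folklore] -/
theorem diff_meet_inter_edgesIn (U : Finset V) (W : Set V) (ω : Set (Sym2 V)) :
    (ω \ {e | ∃ u ∈ e, u ∈ W}) ∩ edgesIn (U.filter fun u => u ∉ W) =
      ω ∩ edgesIn (U.filter fun u => u ∉ W) := by
  ext e
  constructor
  · rintro ⟨⟨hω, -⟩, hU⟩; exact ⟨hω, hU⟩
  · rintro ⟨hω, hU⟩
    exact ⟨⟨hω, fun ⟨u, hue, huW⟩ => (Finset.mem_filter.1 (hU u hue)).2 huW⟩, hU⟩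

/-- `rest U N ω` is `U` filtered by `∉ C_N(ω)`. [folklore] -/
theorem rest_eq_filter (U : Finset V) (N : Set V) (ω : Set (Sym2 V)) :
    rest U N ω = U.filter fun u => u ∉ sC U N ω := rfl

variable [Fintype V]

/-- **Conditioning on the value of the set cluster** (domain Markov property): for every `Φ`,
`Σ_ω weight(ω) Φ(C_N(ω), ω ∩ E(U ∖ C_N(ω))) = Σ_ω weight(ω) Σ_ω' weight(ω') Φ(C_N(ω), ω' ∩ E(U ∖ C_N(ω)))`.
[cite: VandenbergHaggstromKahn2005, §1 pp. 7–8, display (10)] -/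
theorem sum_cond_sC (w : Sym2 V → ℝ) (hm : ∑ ω, weight w ω = 1) (U : Finset V) (N : Set V)
    (Φ : Set V → Set (Sym2 V) → ℝ) :
    ∑ ω, weight w ω * Φ (sC U N ω) (ω ∩ edgesIn (rest U N ω)) =
      ∑ ω, weight w ω * ∑ ω', weight w ω' * Φ (sC U N ω) (ω' ∩ edgesIn (rest U N ω)) := by
  -- fibrewise over the value `W` of the cluster
  have key : ∀ W : Set V,
      ∑ ω, (if sC U N ω = W then weight w ω * Φ W (ω ∩ edgesIn (U.filter fun u => u ∉ W)) else 0) =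
      ∑ ω, (if sC U N ω = W then
        weight w ω * ∑ ω', weight w ω' * Φ W (ω' ∩ edgesIn (U.filter fun u => u ∉ W)) else 0) := by
    intro W
    set A : Set (Sym2 V) := {e | ∃ u ∈ e, u ∈ W} with hA
    set Ψ : Set (Sym2 V) → Set (Sym2 V) → ℝ := fun ζ η =>
      if sC U N ζ = W then Φ W (η ∩ edgesIn (U.filter fun u => u ∉ W)) else 0 with hΨ
    have h1 : ∀ ω, (if sC U N ω = W then weight w ω * Φ W (ω ∩ edgesIn (U.filter fun u => u ∉ W)) else 0) =
        weight w ω * Ψ (ω ∩ A) (ω \ A) := by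
      intro ω
      simp only [hΨ, hA, sC_inter_meet_eq_iff, diff_meet_inter_edgesIn]
      split_ifs <;> simp
    have h2 : ∀ ω ω', Ψ (ω ∩ A) (ω' \ A) =
        if sC U N ω = W then Φ W (ω' ∩ edgesIn (U.filter fun u => u ∉ W)) else 0 := by
      intro ω ω'
      simp only [hΨ, hA, sC_inter_meet_eq_iff, diff_meet_inter_edgesIn]
    calc ∑ ω, (if sC U N ω = W then weight w ω * Φ W (ω ∩ edgesIn (U.filter fun u => u ∉ W)) else 0)
        = (∑ ω, weight w ω) * ∑ ω, weight w ω * Ψ (ω ∩ A) (ω \ A) := by rw [hm, one_mul]; simp_rw [h1]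
      _ = ∑ ω, weight w ω * ∑ ω', weight w ω' * Ψ (ω ∩ A) (ω' \ A) := blockFubini w A Ψ
      _ = _ := by
          refine Finset.sum_congr rfl fun ω _ => ?_
          by_cases hc : sC U N ω = W <;> simp [h2, hc]
  -- combine the fibres
  have lhs : ∑ ω, weight w ω * Φ (sC U N ω) (ω ∩ edgesIn (rest U N ω)) =
      ∑ ω, ∑ W : Set V, (if sC U N ω = W then
        weight w ω * Φ W (ω ∩ edgesIn (U.filter fun u => u ∉ W)) else 0) := by
    refine Finset.sum_congr rfl fun ω _ => ?_
    rw [Finset.sum_ite_eq Finset.univ (sC U N ω)]; simp [rest_eq_filter]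
  have rhs : ∑ ω, weight w ω * ∑ ω', weight w ω' * Φ (sC U N ω) (ω' ∩ edgesIn (rest U N ω)) =
      ∑ ω, ∑ W : Set V, (if sC U N ω = W then
        weight w ω * ∑ ω', weight w ω' * Φ W (ω' ∩ edgesIn (U.filter fun u => u ∉ W)) else 0) := by
    refine Finset.sum_congr rfl fun ω _ => ?_
    rw [Finset.sum_ite_eq Finset.univ (sC U N ω)]; simp [rest_eq_filter]
  rw [lhs, rhs, Finset.sum_comm]
  conv_rhs => rw [Finset.sum_comm]
  exact Finset.sum_congr rfl fun W _ => key W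

/-! ### Adding one source vertex -/

omit [Fintype V] in
/-- Clusters computed from `ω ∩ E(U')` are the clusters of `G[U']`. [folklore] -/
theorem sC_inter_edgesIn (U' : Finset V) (M : Set V) (ω : Set (Sym2 V)) :
    sC U' M (ω ∩ edgesIn U') = sC U' M ω := by
  simp only [sC, Set.inter_assoc, Set.inter_self]

omit [Fintype V] in
/-- Worlds computed from `ω ∩ E(U')` are the worlds of `G[U']`. [folklore] -/
theorem rest_inter_edgesIn (U' : Finset V) (M : Set V) (ω : Set (Sym2 V)) :
    rest U' M (ω ∩ edgesIn U') = rest U' M ω := by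
  ext u; rw [mem_rest, mem_rest, sC_inter_edgesIn]

omit [Fintype V] in
/-- Avoidance events computed from `ω ∩ E(U')`. [folklore] -/
theorem mem_rD_inter_edgesIn (U' : Finset V) (s : V) (M : Set V) (ω : Set (Sym2 V)) :
    ω ∩ edgesIn U' ∈ rD U' s M ↔ ω ∈ rD U' s M := by
  simp only [rD, Set.mem_setOf_eq, Set.inter_assoc, Set.inter_self]

omit [Fintype V] in
/-- If `u ∈ C_N` then `C_{N ∪ {u}} = C_N`. [folklore] -/
theorem sC_insert_of_mem {U : Finset V} {N : Set V} {ω : Set (Sym2 V)} {u : V} (hu : u ∈ sC U N ω) :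
    sC U (insert u N) ω = sC U N ω := by
  refine Set.Subset.antisymm ?_ (sC_mono_set U (Set.subset_insert u N) ω)
  rintro a ⟨z, rfl | hz, hr⟩
  · obtain ⟨z', hz', hr'⟩ := hu
    exact ⟨z', hz', hr'.trans hr⟩
  · exact ⟨z, hz, hr⟩

omit [Fintype V] in
/-- A `U`-path avoiding the cluster `C_N` is a path of the world `U ∖ C_N`: if `a ∉ C_N(ω)` then
`a ↔ b` in `G[U]` iff `a ↔ b` in `G[U ∖ C_N(ω)]`. [folklore] -/
theorem reach_rest_iff {U : Finset V} {N : Set V} {ω : Set (Sym2 V)} {a b : V} (ha : a ∉ sC U N ω) :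
    (openGraph (ω ∩ edgesIn (rest U N ω))).Reachable a b ↔ (openGraph (ω ∩ edgesIn U)).Reachable a b := by
  constructor
  · exact fun h => h.mono (openGraph_le (Set.inter_subset_inter_right _ (edgesIn_mono (rest_subset U N ω))))
  · intro h
    rw [SimpleGraph.reachable_iff_reflTransGen] at h ⊢
    induction h with
    | refl => exact Relation.ReflTransGen.refl
    | @tail b c hab hbc ih =>
      obtain ⟨hω, ⟨hbU, hcU⟩, hne⟩ := adj_iff.1 hbc
      -- `b ∉ C_N` (else `a ∈ C_N`), hence `c ∉ C_N`
      have hb : b ∉ sC U N ω := fun ⟨z, hz, hr⟩ =>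
        ha ⟨z, hz, hr.trans ((SimpleGraph.reachable_iff_reflTransGen _ _).2 hab).symm⟩
      have hc : c ∉ sC U N ω := fun ⟨z, hz, hr⟩ =>
        hb ⟨z, hz, hr.trans (SimpleGraph.Adj.reachable (adj_iff.2 ⟨by rw [Sym2.eq_swap]; exact hω, ⟨hcU, hbU⟩, hne.symm⟩))⟩
      exact ih.tail (adj_iff.2 ⟨hω, ⟨mem_rest.2 ⟨hbU, hb⟩, mem_rest.2 ⟨hcU, hc⟩⟩, hne⟩)

omit [Fintype V] in
/-- If `u ∉ C_N` then `C_{N ∪ {u}} = C_N ∪ C^{U ∖ C_N}_u`. [folklore] -/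
theorem sC_insert_of_not_mem {U : Finset V} {N : Set V} {ω : Set (Sym2 V)} {u : V} (hu : u ∉ sC U N ω) :
    sC U (insert u N) ω = sC U N ω ∪ sC (rest U N ω) ({u} : Set V) ω := by
  ext a
  simp only [Set.mem_union, mem_sC_singleton, reach_rest_iff hu]
  constructor
  · rintro ⟨z, rfl | hz, hr⟩
    · exact Or.inr hr
    · exact Or.inl ⟨z, hz, hr⟩
  · rintro (⟨z, hz, hr⟩ | hr)
    · exact ⟨z, Set.mem_insert_of_mem u hz, hr⟩
    · exact ⟨u, Set.mem_insert u N, hr⟩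

omit [Fintype V] in
/-- If `u ∉ C_N` then `U ∖ C_{N ∪ {u}} = (U ∖ C_N) ∖ C^{U∖C_N}_u`. [folklore] -/
theorem rest_insert_of_not_mem {U : Finset V} {N : Set V} {ω : Set (Sym2 V)} {u : V} (hu : u ∉ sC U N ω) :
    rest U (insert u N) ω = rest (rest U N ω) ({u} : Set V) ω := by
  ext a
  rw [mem_rest, mem_rest, mem_rest, sC_insert_of_not_mem hu, Set.mem_union]
  tauto

/-- **Adding a source vertex decreases `Y`**: if `Y_{U'}({u}) ≤ B_{U'}` in every
sub-world `U' ⊆ U`, then `Y_U(N ∪ {u}) ≤ Y_U(N)`. [cite: VandenbergHaggstromKahn2005, §1 pp. 7–8] -/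
theorem Yf_insert_le (w : Sym2 V → ℝ) (hw0 : ∀ e, 0 ≤ w e) (hw1 : ∀ e, w e ≤ 1)
    (hm : ∑ ω, weight w ω = 1) (x v : V) (Ψ : Set V → ℝ) (U : Finset V)
    (hYB : ∀ U' ⊆ U, ∀ u : V, Yf w U' x v Ψ {u} ≤ Bf w U' x v Ψ) (N : Set V) (u : V) :
    Yf w U x v Ψ (insert u N) ≤ Yf w U x v Ψ N := by
  -- the integrand of `Y(N ∪ {u})` as a function of `(C_N, ω ∩ E(U ∖ C_N))`
  set Φ : Set V → Set (Sym2 V) → ℝ := fun W η =>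
    ind {W : Set V | x ∉ W} W * (if u ∈ W then Bf w (U.filter fun a => a ∉ W) x v Ψ else
      Bf w (rest (U.filter fun a => a ∉ W) ({u} : Set V) η) x v Ψ *
        ind (rD (U.filter fun a => a ∉ W) x ({u} : Set V)) η) with hΦ
  have hxW : ∀ ω : Set (Sym2 V), ind {W : Set V | x ∉ W} (sC U N ω) = ind (rD U x N) ω := by
    intro ω
    by_cases h : x ∈ sC U N ω
    · rw [ind_of_not_mem (show sC U N ω ∉ {W : Set V | x ∉ W} from fun h' => h' h),
        ind_of_not_mem (fun h' => ((not_mem_sC_iff U N ω x).2 h') h)]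
    · rw [ind_of_mem (show sC U N ω ∈ {W : Set V | x ∉ W} from h), ind_of_mem ((not_mem_sC_iff U N ω x).1 h)]
  have hint : ∀ ω : Set (Sym2 V), Bf w (rest U (insert u N) ω) x v Ψ * ind (rD U x (insert u N)) ω =
      Φ (sC U N ω) (ω ∩ edgesIn (rest U N ω)) := by
    intro ω
    simp only [hΦ, hxW, ← rest_eq_filter, rest_inter_edgesIn]
    by_cases hu : u ∈ sC U N ω
    · rw [if_pos hu]
      have hC : sC U (insert u N) ω = sC U N ω := sC_insert_of_mem hu
      have hR : rest U (insert u N) ω = rest U N ω := by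
        ext a; rw [mem_rest, mem_rest, hC]
      rw [hR]
      by_cases hx : ω ∈ rD U x N
      · have hx' : ω ∈ rD U x (insert u N) := by
          rw [← not_mem_sC_iff] at hx ⊢; rwa [hC]
        rw [ind_of_mem hx, ind_of_mem hx', mul_one, one_mul]
      · have hx' : ω ∉ rD U x (insert u N) := fun h => hx (rD_antitone (Set.subset_insert u N) h)
        rw [ind_of_not_mem hx, ind_of_not_mem hx', mul_zero, zero_mul]
    · rw [if_neg hu, rest_insert_of_not_mem hu]
      by_cases hx : ω ∈ rD U x N
      · rw [ind_of_mem hx, one_mul]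
        have hxC : x ∉ sC U N ω := (not_mem_sC_iff U N ω x).2 hx
        have hiff : ω ∈ rD U x (insert u N) ↔ ω ∩ edgesIn (rest U N ω) ∈ rD (rest U N ω) x ({u} : Set V) := by
          rw [mem_rD_inter_edgesIn]
          simp only [rD, Set.mem_setOf_eq, Set.mem_insert_iff, Set.mem_singleton_iff, forall_eq_or_imp, forall_eq,
            reach_rest_iff hxC]
          exact ⟨fun h => h.1, fun h => ⟨h, hx⟩⟩
        by_cases hx' : ω ∈ rD U x (insert u N)
        · rw [ind_of_mem hx', ind_of_mem (hiff.1 hx')]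
        · rw [ind_of_not_mem hx', ind_of_not_mem fun h => hx' (hiff.2 h)]
      · have hx' : ω ∉ rD U x (insert u N) := fun h => hx (rD_antitone (Set.subset_insert u N) h)
        rw [ind_of_not_mem hx, ind_of_not_mem hx', mul_zero, zero_mul]
  -- condition on `C_N`; inside, the `u ∉ W` branch is `Y_{U∖W}({u}) ≤ B_{U∖W}`
  have hdec := sum_cond_sC w hm U N Φ
  unfold Yf
  simp_rw [hint]
  rw [hdec]
  refine Finset.sum_le_sum fun ω _ => mul_le_mul_of_nonneg_left ?_ (weight_nonneg hw0 hw1 ω)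
  simp only [hΦ, ← rest_eq_filter]
  by_cases hu : u ∈ sC U N ω
  · simp only [if_pos hu]
    rw [← Finset.sum_mul, hm, one_mul, hxW]
    exact (mul_comm _ _).le
  · simp only [if_neg hu, hxW]
    have hsum : ∑ ω', weight w ω' * (ind (rD U x N) ω *
        (Bf w (rest (rest U N ω) ({u} : Set V) (ω' ∩ edgesIn (rest U N ω))) x v Ψ *
          ind (rD (rest U N ω) x ({u} : Set V)) (ω' ∩ edgesIn (rest U N ω)))) =
        ind (rD U x N) ω * Yf w (rest U N ω) x v Ψ {u} := by
      unfold Yf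
      rw [Finset.mul_sum]
      refine Finset.sum_congr rfl fun ω' _ => ?_
      rw [rest_inter_edgesIn]
      have : ind (rD (rest U N ω) x ({u} : Set V)) (ω' ∩ edgesIn (rest U N ω)) =
          ind (rD (rest U N ω) x ({u} : Set V)) ω' := by
        by_cases h : ω' ∈ rD (rest U N ω) x ({u} : Set V)
        · rw [ind_of_mem h, ind_of_mem ((mem_rD_inter_edgesIn _ _ _ _).2 h)]
        · rw [ind_of_not_mem h, ind_of_not_mem fun h' => h ((mem_rD_inter_edgesIn _ _ _ _).1 h')]
      rw [this]; ring
    rw [hsum, mul_comm (Bf w (rest U N ω) x v Ψ)]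
    exact mul_le_mul_of_nonneg_left (hYB _ (rest_subset U N ω) u) (ind_nonneg _ _)

/-- **`Y` is antitone in the source set** given the one-source bound `Y_{U'}({u}) ≤ B_{U'}` in every sub-world
. [cite: VandenbergHaggstromKahn2005, §1 pp. 7–8] -/
theorem Yf_antitone_of_le_Bf (w : Sym2 V → ℝ) (hw0 : ∀ e, 0 ≤ w e) (hw1 : ∀ e, w e ≤ 1)
    (hm : ∑ ω, weight w ω = 1) (x v : V) (Ψ : Set V → ℝ) (U : Finset V)
    (hYB : ∀ U' ⊆ U, ∀ u : V, Yf w U' x v Ψ {u} ≤ Bf w U' x v Ψ) {N N' : Set V} (hNN' : N ⊆ N')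
    (hN'U : N' ⊆ ↑U) : Yf w U x v Ψ N' ≤ Yf w U x v Ψ N := by
  -- induction on the finite set `N' ∖ N`
  set D : Finset V := U.filter fun u => u ∈ N' ∧ u ∉ N with hD
  have hN' : N' = N ∪ ↑D := by
    ext u
    simp only [hD, Set.mem_union, Finset.coe_filter, Set.mem_setOf_eq]
    constructor
    · intro hu; by_cases huN : u ∈ N; exacts [Or.inl huN, Or.inr ⟨hN'U hu, hu, huN⟩]
    · rintro (hu | ⟨-, hu, -⟩); exacts [hNN' hu, hu]
  rw [hN']
  clear_value D
  clear hN' hD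
  induction D using Finset.induction_on with
  | empty => simp
  | @insert u D _ ih =>
    rw [Finset.coe_insert, Set.union_insert]
    exact (Yf_insert_le w hw0 hw1 hm x v Ψ U hYB _ u).trans ih

/-- **(A2) modulo the one-source bounds** (★) and (Y ≤ B): for all `N, N' ⊆ U`,
`E_U(N)·Y_U(N') ≤ M_U(N ∪ N')·X_U(N ∩ N')`.
[cite: VandenbergHaggstromKahn2005, Thm. 1.1 (pp. 3–5)] [cite: Gladkov2024, Thm. 3.2] -/
theorem a2 (w : Sym2 V → ℝ) (hw0 : ∀ e, 0 ≤ w e) (hw1 : ∀ e, w e ≤ 1)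
    (hm : ∑ ω, weight w ω = 1) (x o v : V) {Ψ : Set V → ℝ}
    (hΨ : ∀ S T : Set V, S ⊆ T → Ψ S ≤ Ψ T) (hΨ0 : ∀ S, 0 ≤ Ψ S) (U : Finset V)
    (hstar : ∀ U' ⊆ U, ∀ N : Set V, N ⊆ ↑U' →
      Yf w U' x v Ψ N * Mf w U' x v ∅ ≤ Mf w U' x v N * Bf w U' x v Ψ)
    (hYB : ∀ U' ⊆ U, ∀ u : V, Yf w U' x v Ψ {u} ≤ Bf w U' x v Ψ) {N N' : Set V} (hNU : N ⊆ ↑U)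
    (hN'U : N' ⊆ ↑U) :
    Ef w U x o v N * Yf w U x v Ψ N' ≤ Mf w U x v (N ∪ N') * Xf w U x o v Ψ (N ∩ N') :=
  a2_of_star w hw0 hw1 hm x o v hΨ hΨ0 U hstar
    (fun U' hU' _ _ hNN' hN'U' => Yf_antitone_of_le_Bf w hw0 hw1 hm x v Ψ U'
      (fun U'' hU'' => hYB U'' (hU''.trans hU')) hNN' hN'U') N N' hNU hN'U

/-- **P1 ≥ 0 modulo the one-source bounds**: `E({y})·Y({y}) ≤ M({y})·X({y})` in `G[U]`, i.e.
`E_π[(q(C_y) − τ)B(C_y)] ≥ 0`. [cite: VandenbergHaggstromKahn2005, Thm. 1.1 (pp. 3–5)]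
[cite: Gladkov2024, Thm. 3.2] -/
theorem p1 (w : Sym2 V → ℝ) (hw0 : ∀ e, 0 ≤ w e) (hw1 : ∀ e, w e ≤ 1)
    (hm : ∑ ω, weight w ω = 1) (x o v y : V) {Ψ : Set V → ℝ}
    (hΨ : ∀ S T : Set V, S ⊆ T → Ψ S ≤ Ψ T) (hΨ0 : ∀ S, 0 ≤ Ψ S) (U : Finset V) (hy : y ∈ U)
    (hstar : ∀ U' ⊆ U, ∀ N : Set V, N ⊆ ↑U' →
      Yf w U' x v Ψ N * Mf w U' x v ∅ ≤ Mf w U' x v N * Bf w U' x v Ψ)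
    (hYB : ∀ U' ⊆ U, ∀ u : V, Yf w U' x v Ψ {u} ≤ Bf w U' x v Ψ) :
    Ef w U x o v {y} * Yf w U x v Ψ {y} ≤ Mf w U x v {y} * Xf w U x o v Ψ {y} := by
  have h := a2 w hw0 hw1 hm x o v hΨ hΨ0 U hstar hYB (N := {y}) (N' := {y})
    (Set.singleton_subset_iff.2 hy) (Set.singleton_subset_iff.2 hy)
  simpa only [Set.union_self, Set.inter_self] using h

end Summit.CriticalPhenomena.PercolationContinuityZ3.Theorems.CovTau
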